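import Literature.Computability.Cryptography.RegevSamplerBlockStd
import Literature.Computability.Cryptography.RegevSamplerMachinePar
import Literature.Computability.Cryptography.RegevSamplerSrcStd
import HarnessLib

/-!
# Regev 2009, Lemma 3.14 in machine form: the per-block bound for the DATA-FREE machine circuit

Topic `Computability/Cryptography` (family `pqc`), grouping namespace `Regev2009.SamplerRegs`; sequel of
`RegevSamplerBlockStd.lean` (`tvDist_machineCirc_le_std`: the per-block bound of A_q14 clause 2 on the standard layout,
for the machine circuit `machineCirc … (GRData.eraseList m E)` whose erase layer still carries the Grover–Rudolph parameter
word `m.c`), `RegevSamplerMachinePar.lean` (`machineCircPar`: the parameter word erased by `CNOT`s controlled on classical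
sources; `runOn_machineCircPar_eq_runOn_machineCirc`) and `RegevSamplerSrcStd.lean` (`srcU`: the sources inside the input
zone at a fixed offset `p₀`; `offBlocks_srcU`, `boxLab_lab₀_srcU_eq`).

* `tvDist_machineCircPar_le_std` — **the same per-block bound for `machineCircPar … (srcU I Λ p₀)`** when the classical
  preprocessing writes the parameter word into the padding of the input zone (`pad := padWord g m.c pad'`,
  `|Fq| + |⟨code Pa⟩| + g = p₀`, `p₀ + np ≤ L`). The circuit's gate list now depends on the instance only through the
  SIZES (`n, e, T, m, L, Lq, W, np, U, p₀` and the oracle family) — `machineCircPar_eq_canonical` records that the instance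
  `B` and the scale data `S` may be replaced by the canonical `⟨n, 1⟩` and any `S'` without changing the circuit (`rfl`).
  This is the last state-level ingredient of the uniform inner family of the classical wrap (gen-11 M1/M2): what remains
  is the length code of the sizes, the uniformity of the three layers' descriptions, and the assembly through `CWrap`.

Everything is proved; no named fact is introduced; the constant is still `C = 8` and the slack `νlevel`.
HONEST FRAMING: kernel-checked lemmas of a KNOWN reduction (Regev 2009) — not summit progress; A_q14 is not proved here.

## References

* O. Regev, *On lattices, learning with errors, random linear codes, and cryptography*, J. ACM 56 (2009), art. 34:
  Lemma 3.14 (statement and proof), Lemma 3.12 (proof) [Regev2009].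
* M. A. Nielsen, I. L. Chuang, *Quantum Computation and Quantum Information*, CUP 2010, §3.2.5, §4.3, §5.1 [NielsenChuang2010].
* L. Grover, T. Rudolph, *Creating superpositions that correspond to efficiently integrable probability distributions*,
  arXiv:quant-ph/0208112 (2002) [GroverRudolph2002].
-/

noncomputable section

namespace Literature.Computability.Cryptography

namespace Regev2009

namespace SamplerRegs

open Literature.Algebra.EuclideanLattices Literature.Algebra.EuclideanLattices.Regev2009
  Literature.Algebra.EuclideanLattices.Regev2009.QPart Literature.Computability.QuantumComplexity
  Literature.Computability.QuantumComplexity.GaussianCells Literature.Computability.QuantumComplexity.GroverRudolph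
  Literature.Computability.QuantumComplexity.GRWord Literature.Computability.QuantumComplexity.QFTQubits
  Literature.Computability.QuantumComplexity.QFTWord Literature.Computability.QuantumComplexity.TidyBlockFn
  Literature.Computability.QuantumComplexity.QState Literature.Computability.QuantumComplexity.GRMassTable
  Literature.Computability.QuantumComplexity.GRTableMach
  Literature.Computability.Complexity Literature.LinearAlgebra.Matrix.Berkowitz Peikert2009 Finset _root_.Matrix SamplerArith
  SamplerScale SamplerGeom SamplerWords SamplerWordFns SamplerFormats SamplerQuery CVPOracle SamplerClassical
  SamplerClassical.Layout SamplerSubst SamplerDecode _root_.Computability Module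
open Literature.Computability.QuantumComplexity.GRCosineMach (pcode abs_cosA_le_one cosA_update)
open scoped Real

/-! ### The circuit is a function of the sizes -/

/-- **The data-free machine circuit does not depend on the instance beyond its dimension** (the basis enters only the
INPUT label): replacing `B` by the canonical `⟨n, 1⟩` gives the same circuit, definitionally. [cite: Regev2009, Lemma 3.14 (proof)] -/
theorem machineCircPar_eq_canonical {W' : ℕ} (I : LatticeInstance) {Λ : Layout W' I.n} (hΛ : Λ.OK) (hF : Fits Λ)
    (Rf : UniformQCircuitFamily) (Z : SubZone Λ (Rf.family.ancillas Λ.kq))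
    {np wlen kk : ℕ} {ag : Fin Λ.ℓ → (Fin Λ.ℓ → Bool) → ℝ}
    (D : GRBlock.Data (GRData.kit Λ.ℓ np wlen kk) (GRData.ws Λ.ℓ np wlen kk) (GRData.pw Λ.ℓ np wlen kk) ag)
    (E : Fin I.n → (Fin (GRData.B Λ.ℓ np wlen kk) ↪ Fin W')) (src : Fin np → Fin W')
    (kF : ℕ) (hk : 1 ≤ kF) (hroom : Λ.base + I.n * QFTKit.qbsize Λ.ℓR kF ≤ W') :
    machineCircPar I hΛ hF Rf Z D E src kF hk hroom =
      machineCircPar (⟨I.n, 1⟩ : LatticeInstance) (Λ := Λ) hΛ hF Rf Z D E src kF hk hroom := rfl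

/-- **… nor on the scale datum `S` of the mass table** (it enters only the parameter word, i.e. the INPUT label):
replacing `S` by any `S'` gives the same circuit, definitionally. [cite: Regev2009, Lemma 3.14 (proof)] -/
theorem machineCircPar_eq_of_table {W' : ℕ} (I : LatticeInstance) {Λ : Layout W' I.n} (hΛ : Λ.OK) (hF : Fits Λ)
    (Rf : UniformQCircuitFamily) (Z : SubZone Λ (Rf.family.ancillas Λ.kq)) (τ : LevelCode)
    (S S' : ℚ) (p U k np : ℕ)
    (hnp : (pcode ((S, (p, U)), (k, Λ.ℓ))).length ≤ np) (hnp' : (pcode ((S', (p, U)), (k, Λ.ℓ))).length ≤ np)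
    (E : Fin I.n → (Fin (GRData.B Λ.ℓ np (wlen τ Λ.ℓ np) (k + 1)) ↪ Fin W')) (src : Fin np → Fin W')
    (kF : ℕ) (hk : 1 ≤ kF) (hroom : Λ.base + I.n * QFTKit.qbsize Λ.ℓR kF ≤ W') :
    machineCircPar I hΛ hF Rf Z (GRTableMach.data τ S p U k Λ.ℓ np hnp) E src kF hk hroom =
      machineCircPar I hΛ hF Rf Z (GRTableMach.data τ S' p U k Λ.ℓ np hnp') E src kF hk hroom := rfl

/-! ### The per-block bound for the data-free circuit -/

/-- A `CNOT` layer is oracle-free. [folklore] -/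
theorem cnotLayer_isOracleFree {W' : ℕ} (σ : Fin W' → Fin W') (T : List (Fin W')) : (cnotLayer σ T).IsOracleFree :=
  revCompile_isOracleFree _

/-- **The data-free machine circuit is oracle-free** (the `CVP` subroutine family being oracle-free) — the `hfree` input of
`QCircuitFamily.isUniform_of_abstract` for the inner family. [cite: Regev2009, Lemma 3.14 (proof), Lemma 3.3 (proof)] -/
theorem isOracleFree_machineCircPar {W' : ℕ} (I : LatticeInstance) {Λ : Layout W' I.n} (hΛ : Λ.OK) (hF : Fits Λ)
    (Rf : UniformQCircuitFamily) (Z : SubZone Λ (Rf.family.ancillas Λ.kq))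
    {np wlen kk : ℕ} {ag : Fin Λ.ℓ → (Fin Λ.ℓ → Bool) → ℝ}
    (D : GRBlock.Data (GRData.kit Λ.ℓ np wlen kk) (GRData.ws Λ.ℓ np wlen kk) (GRData.pw Λ.ℓ np wlen kk) ag)
    (E : Fin I.n → (Fin (GRData.B Λ.ℓ np wlen kk) ↪ Fin W')) (src : Fin np → Fin W')
    (kF : ℕ) (hk : 1 ≤ kF) (hroom : Λ.base + I.n * QFTKit.qbsize Λ.ℓR kF ≤ W') :
    (machineCircPar I hΛ hF Rf Z D E src kF hk hroom).IsOracleFree := by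
  intro g hg
  simp only [machineCircPar, machineCircU, QCircuit.append, List.mem_append] at hg
  rcases hg with ((hg | hg) | hg) | hg
  · exact GRStage.stageCircuit_isOracleFree D E g hg
  · exact cnotLayer_isOracleFree _ _ g hg
  · exact isOracleFree_stageCirc hΛ hF (subE hΛ Z) (tidyCirc_isOracleFree (Rf.isOracleFree Λ.kq)) g hg
  · exact QFTStage.stageCircuit_isOracleFree _ hk g hg

/-- **The gate list of the data-free machine circuit**: GR stage, erase layer, oracle stage, QFT stage — the shape the
stage-wise abstraction (`List.map AJLCore.toAG`, `List.map_append`) consumes. [cite: NielsenChuang2010, §4.2] -/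
theorem gates_machineCircPar {W' : ℕ} (I : LatticeInstance) {Λ : Layout W' I.n} (hΛ : Λ.OK) (hF : Fits Λ)
    (Rf : UniformQCircuitFamily) (Z : SubZone Λ (Rf.family.ancillas Λ.kq))
    {np wlen kk : ℕ} {ag : Fin Λ.ℓ → (Fin Λ.ℓ → Bool) → ℝ}
    (D : GRBlock.Data (GRData.kit Λ.ℓ np wlen kk) (GRData.ws Λ.ℓ np wlen kk) (GRData.pw Λ.ℓ np wlen kk) ag)
    (E : Fin I.n → (Fin (GRData.B Λ.ℓ np wlen kk) ↪ Fin W')) (src : Fin np → Fin W')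
    (kF : ℕ) (hk : 1 ≤ kF) (hroom : Λ.base + I.n * QFTKit.qbsize Λ.ℓR kF ≤ W') :
    (machineCircPar I hΛ hF Rf Z D E src kF hk hroom).gates =
      (GRStage.stageCircuit D E).gates ++ (cnotLayer (GRData.parSrc E src) (GRData.parList E)).gates ++
        (stageCirc hΛ hF (subE hΛ Z) (tidyCirc (ℓ := I.n * Λ.bc) (Rf.family.circ Λ.kq))).gates ++
          (QFTStage.stageCircuit (qftBlock I hΛ kF hroom) hk).gates := rfl

section Par

variable (I : LatticeInstance) [IsZLattice ℝ I.lattice] [NeZero I.n] (e T m L Lq W : ℕ) (hW : 0 < W)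

local notation "ΛS" => schedLayout (LatticeInstance.n I) e T m L Lq W hW

open Classical in
/-- **Regev 2009, Lemma 3.14 — the per-block bound for the data-free machine circuit on the standard layout.**
As `tvDist_machineCirc_le_std`, for `machineCircPar … (srcU B Λ p₀)` and the input zone
`zoneOf Fq Pa (padWord g c pad')` carrying the parameter word `c = (mach …).c` at offset `p₀` (`p₀ + np ≤ L`).
[cite: Regev2009, Lemma 3.14 (statement and proof), Lemma 3.12 (proof)] [cite: NielsenChuang2010, §3.2.5, §4.3] -/
theorem tvDist_machineCircPar_le_std (hI : I.IsNonsingular) (he : I.encode.length ≤ e) (hne : I.n ≤ e) (he2 : 2 ≤ e)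
    (hn5 : 5 ≤ I.n) (hm : schedL I.n e T 0 + 13 ≤ m)
    (hLq : Lq ≤ L) (hX : I.n * schedL I.n e T m ≤ L) (hY : I.n * schedY I.n e ≤ L) (hS : I.n * schedR I.n e T m ≤ L)
    (hWY : topY I.n (schedL I.n e T m) (schedY I.n e) (schedR I.n e T m) (schedB I.n e T) L Lq ≤ W)
    (hWS : topS I.n (schedL I.n e T m) (schedY I.n e) (schedR I.n e T m) (schedB I.n e T) L Lq ≤ W)
    (hWX : topX I.n (schedL I.n e T m) (schedY I.n e) (schedR I.n e T m) (schedB I.n e T) L Lq ≤ W)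
    (hWF : stdBase I.n (schedL I.n e T m) (schedY I.n e) (schedR I.n e T m) (schedB I.n e T) L +
      I.n * QFTKit.qbsize (schedR I.n e T m) (2 * m + 4) ≤ W)
    (aq ρ : ℚ) (haq : 0 < aq) (hρ : 0 < ρ)
    (htT : tW (aq : ℝ) (ρ : ℝ) I.n ≤ (2 : ℝ) ^ T) (hTt : (2⁻¹ : ℝ) ^ T ≤ tW (aq : ℝ) (ρ : ℝ) I.n)
    (hprom : (aq : ℝ) / (Real.sqrt 2 * ρ) < minNorm (dualLattice I.lattice) / 2)
    (r : ℚ) (k : ℕ) (y : List Bool) (e' : ℚ) (Fq pad' : List Bool)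
    (hFq0 : Fq = boolPair (boolPair (stageInput (GapSVPInstance.encode (I, r)) (k + 1) y)
      (boolPair (encodeNat (schedR I.n e T m)) (encodeNat (schedB I.n e T)))) [])
    (hFq : Fq.length = Lq)
    (Rf : UniformQCircuitFamily)
    (hWZ : stdBase I.n (schedL I.n e T m) (schedY I.n e) (schedR I.n e T m) (schedB I.n e T) L +
      ((ΛS).kq + Rf.family.ancillas (ΛS).kq) ≤ W)
    (U np : ℕ)
    (hnp : (pcode ((Spar (2 ^ schedR I.n e T m) (detA I) aq ρ I.n, (4 * (2 * m + schedL I.n e T m + 3), U)),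
      (2 * m + 1, schedL I.n e T m))).length ≤ np)
    (p₀ g : ℕ) (hp : p₀ + np ≤ L)
    (hg : Fq.length + (boolPair (pallE ((parOf I, 2 ^ schedR I.n e T m), e')) []).length + g = p₀)
    (huz : (zoneOf Fq ((parOf I, 2 ^ schedR I.n e T m), e') (padWord g (mach LevelCode.clamp (Spar (2 ^ schedR I.n e T m) (detA I) aq ρ I.n)
                (4 * (2 * m + schedL I.n e T m + 3)) U (2 * m + 1) (schedL I.n e T m) np hnp).c pad')).length = L)
    (hWE : stdBase I.n (schedL I.n e T m) (schedY I.n e) (schedR I.n e T m) (schedB I.n e T) L +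
      I.n * GRData.B (schedL I.n e T m) np (wlen LevelCode.clamp (schedL I.n e T m) np) (2 * m + 1 + 1) ≤ W)
    (x' : EuclideanSpace ℝ (Fin I.n)) (hU : 6 * (4 * (2 * m + schedL I.n e T m + 3) + schedL I.n e T m + 3) ≤ U) :
    ((bornPMF ((machineCircPar I (schedLayout_OK hW hLq hX hY hS hWF) (schedLayout_fits hW hWY hWS hWX) Rf
              (stdZone ΛS (schedLayout_OK hW hLq hX hY hS hWF) hWZ)
              (GRTableMach.data LevelCode.clamp (Spar (2 ^ schedR I.n e T m) (detA I) aq ρ I.n)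
                (4 * (2 * m + schedL I.n e T m + 3)) U (2 * m + 1) (schedL I.n e T m) np hnp)
              (stdEmb I (schedLayout_OK hW hLq hX hY hS hWF) hWE)
              (srcU I ΛS p₀)
              (2 * m + 4) (by omega) hWF).runOn 0
          (basisState (boxLab (stdEmb I (schedLayout_OK hW hLq hX hY hS hWF) hWE)
              (GRData.ws (schedL I.n e T m) np (wlen LevelCode.clamp (schedL I.n e T m) np) (2 * m + 1 + 1))
            (GRData.init (mach LevelCode.clamp (Spar (2 ^ schedR I.n e T m) (detA I) aq ρ I.n)
              (4 * (2 * m + schedL I.n e T m + 3)) U (2 * m + 1) (schedL I.n e T m) np hnp))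
            (lab₀ I ΛS (2 ^ schedR I.n e T m) (tW (aq : ℝ) (ρ : ℝ) I.n) (zoneOf Fq ((parOf I, 2 ^ schedR I.n e T m), e')
              (padWord g (mach LevelCode.clamp (Spar (2 ^ schedR I.n e T m) (detA I) aq ρ I.n)
                (4 * (2 * m + schedL I.n e T m + 3)) U (2 * m + 1) (schedL I.n e T m) np hnp).c pad')) x')
            fun _ => GRData.init (mach LevelCode.clamp (Spar (2 ^ schedR I.n e T m) (detA I) aq ρ I.n)
              (4 * (2 * m + schedL I.n e T m + 3)) U (2 * m + 1) (schedL I.n e T m) np hnp) ∘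
              GRData.ws (schedL I.n e T m) np (wlen LevelCode.clamp (schedL I.n e T m) np) (2 * m + 1 + 1))))).map
        fun z => decZ I (2 ^ schedR I.n e T m) (readS (Sblk I (schedLayout_OK (n := I.n) (e := e) (T := T) (m := m) hW hLq hX hY hS hWF)) z)).tvDist
      ((discreteGaussian I.lattice ((ρ : ℝ) * Real.sqrt I.n / aq) 0).map I.intCoords) ≤
      8 * Real.sqrt (weightedFail Rf I r k y ((aq : ℝ) / (Real.sqrt 2 * ρ))
              (dataLaw (boxSet I.n (schedL I.n e T m) (DT I (2 ^ schedR I.n e T m) (tW (aq : ℝ) (ρ : ℝ) I.n)))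
                (fun x => (gaussianFunction 1 x / zBox (boxSet I.n (schedL I.n e T m) (DT I (2 ^ schedR I.n e T m) (tW (aq : ℝ) (ρ : ℝ) I.n)))) ^ 2)
                (fun _ _ => sq_nonneg _)
                (sum_boxWeight_eq_one (boxSet_nonempty I.n (schedL I.n e T m) (DT I (2 ^ schedR I.n e T m) (tW (aq : ℝ) (ρ : ℝ) I.n))))
                (cOf I ΛS (tW (aq : ℝ) (ρ : ℝ) I.n)))).toReal + νlevel I.n := by
  have hfit := blocksFit_stdEmb I (schedLayout_OK hW hLq hX hY hS hWF)
    (GRData.ws (schedL I.n e T m) np (wlen LevelCode.clamp (schedL I.n e T m) np) (2 * m + 1 + 1))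
    (fun j => ws_val (schedL I.n e T m) np (wlen LevelCode.clamp (schedL I.n e T m) np) (2 * m + 1 + 1) j) hWE
  have key := runOn_machineCircPar_eq_runOn_machineCirc I (schedLayout_OK hW hLq hX hY hS hWF) (schedLayout_fits hW hWY hWS hWX) Rf
    (stdZone ΛS (schedLayout_OK hW hLq hX hY hS hWF) hWZ)
    (mach LevelCode.clamp (Spar (2 ^ schedR I.n e T m) (detA I) aq ρ I.n)
                (4 * (2 * m + schedL I.n e T m + 3)) U (2 * m + 1) (schedL I.n e T m) np hnp)
    (GRTableMach.data LevelCode.clamp (Spar (2 ^ schedR I.n e T m) (detA I) aq ρ I.n)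
                (4 * (2 * m + schedL I.n e T m + 3)) U (2 * m + 1) (schedL I.n e T m) np hnp)
    hfit.disj (srcU I ΛS p₀)
    (offBlocks_srcU I (schedLayout_OK hW hLq hX hY hS hWF) hfit hp) _
    (boxLab_lab₀_srcU_eq I (schedLayout_OK hW hLq hX hY hS hWF) hfit hp
      (GRData.init (mach LevelCode.clamp (Spar (2 ^ schedR I.n e T m) (detA I) aq ρ I.n)
                (4 * (2 * m + schedL I.n e T m + 3)) U (2 * m + 1) (schedL I.n e T m) np hnp))
      (fun _ => GRData.init (mach LevelCode.clamp (Spar (2 ^ schedR I.n e T m) (detA I) aq ρ I.n)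
                (4 * (2 * m + schedL I.n e T m + 3)) U (2 * m + 1) (schedL I.n e T m) np hnp) ∘
              GRData.ws (schedL I.n e T m) np (wlen LevelCode.clamp (schedL I.n e T m) np) (2 * m + 1 + 1))
      (2 ^ schedR I.n e T m) (tW (aq : ℝ) (ρ : ℝ) I.n) Fq _ g
      (mach LevelCode.clamp (Spar (2 ^ schedR I.n e T m) (detA I) aq ρ I.n)
                (4 * (2 * m + schedL I.n e T m + 3)) U (2 * m + 1) (schedL I.n e T m) np hnp).c pad' hg x')
    (2 * m + 4) (by omega) hWF
  have std := tvDist_machineCirc_le_std I e T m L Lq W hW hI he hne he2 hn5 hm hLq hX hY hS hWY hWS hWX hWF aq ρ haq hρ htT hTt hprom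
    r k y e' Fq _ hFq0 hFq huz Rf hWZ U np hnp hWE x' hU
  exact (congrArg (fun ψ : QReg W → ℂ => ((bornPMF ψ).map fun z => decZ I (2 ^ schedR I.n e T m)
    (readS (Sblk I (schedLayout_OK (n := I.n) (e := e) (T := T) (m := m) hW hLq hX hY hS hWF)) z)).tvDist
      ((discreteGaussian I.lattice ((ρ : ℝ) * Real.sqrt I.n / aq) 0).map I.intCoords)) key).trans_le std

/-- **The per-block bound with the CANONICAL circuit**: the circuit of `tvDist_machineCircPar_le_std` written for the
canonical instance `⟨n, 1⟩` and an arbitrary table datum `S₀` (with its own code-length witness `hnp₀`) — literally the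
circuit the inner uniform family places at the length code of the sizes; the instance `B`, the scale `Spar …` and the
parameter word enter only the input label. (The two forms are definitionally equal: `machineCircPar_eq_canonical`,
`machineCircPar_eq_of_table`.) [cite: Regev2009, Lemma 3.14 (statement and proof)] [cite: NielsenChuang2010, §4.5] -/
theorem tvDist_machineCircPar_le_canonical (hI : I.IsNonsingular) (he : I.encode.length ≤ e) (hne : I.n ≤ e) (he2 : 2 ≤ e)
    (hn5 : 5 ≤ I.n) (hm : schedL I.n e T 0 + 13 ≤ m)
    (hLq : Lq ≤ L) (hX : I.n * schedL I.n e T m ≤ L) (hY : I.n * schedY I.n e ≤ L) (hS : I.n * schedR I.n e T m ≤ L)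
    (hWY : topY I.n (schedL I.n e T m) (schedY I.n e) (schedR I.n e T m) (schedB I.n e T) L Lq ≤ W)
    (hWS : topS I.n (schedL I.n e T m) (schedY I.n e) (schedR I.n e T m) (schedB I.n e T) L Lq ≤ W)
    (hWX : topX I.n (schedL I.n e T m) (schedY I.n e) (schedR I.n e T m) (schedB I.n e T) L Lq ≤ W)
    (hWF : stdBase I.n (schedL I.n e T m) (schedY I.n e) (schedR I.n e T m) (schedB I.n e T) L +
      I.n * QFTKit.qbsize (schedR I.n e T m) (2 * m + 4) ≤ W)
    (aq ρ : ℚ) (haq : 0 < aq) (hρ : 0 < ρ)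
    (htT : tW (aq : ℝ) (ρ : ℝ) I.n ≤ (2 : ℝ) ^ T) (hTt : (2⁻¹ : ℝ) ^ T ≤ tW (aq : ℝ) (ρ : ℝ) I.n)
    (hprom : (aq : ℝ) / (Real.sqrt 2 * ρ) < minNorm (dualLattice I.lattice) / 2)
    (r : ℚ) (k : ℕ) (y : List Bool) (e' : ℚ) (Fq pad' : List Bool)
    (hFq0 : Fq = boolPair (boolPair (stageInput (GapSVPInstance.encode (I, r)) (k + 1) y)
      (boolPair (encodeNat (schedR I.n e T m)) (encodeNat (schedB I.n e T)))) [])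
    (hFq : Fq.length = Lq)
    (Rf : UniformQCircuitFamily)
    (hWZ : stdBase I.n (schedL I.n e T m) (schedY I.n e) (schedR I.n e T m) (schedB I.n e T) L +
      ((ΛS).kq + Rf.family.ancillas (ΛS).kq) ≤ W)
    (U np : ℕ)
    (hnp : (pcode ((Spar (2 ^ schedR I.n e T m) (detA I) aq ρ I.n, (4 * (2 * m + schedL I.n e T m + 3), U)),
      (2 * m + 1, schedL I.n e T m))).length ≤ np)
    (S₀ : ℚ) (hnp₀ : (pcode ((S₀, (4 * (2 * m + schedL I.n e T m + 3), U)), (2 * m + 1, schedL I.n e T m))).length ≤ np)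
    (p₀ g : ℕ) (hp : p₀ + np ≤ L)
    (hg : Fq.length + (boolPair (pallE ((parOf I, 2 ^ schedR I.n e T m), e')) []).length + g = p₀)
    (huz : (zoneOf Fq ((parOf I, 2 ^ schedR I.n e T m), e') (padWord g (mach LevelCode.clamp (Spar (2 ^ schedR I.n e T m) (detA I) aq ρ I.n)
                (4 * (2 * m + schedL I.n e T m + 3)) U (2 * m + 1) (schedL I.n e T m) np hnp).c pad')).length = L)
    (hWE : stdBase I.n (schedL I.n e T m) (schedY I.n e) (schedR I.n e T m) (schedB I.n e T) L +
      I.n * GRData.B (schedL I.n e T m) np (wlen LevelCode.clamp (schedL I.n e T m) np) (2 * m + 1 + 1) ≤ W)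
    (x' : EuclideanSpace ℝ (Fin I.n)) (hU : 6 * (4 * (2 * m + schedL I.n e T m + 3) + schedL I.n e T m + 3) ≤ U) :
    ((bornPMF ((machineCircPar (⟨I.n, 1⟩ : LatticeInstance) (Λ := ΛS) (schedLayout_OK hW hLq hX hY hS hWF)
              (schedLayout_fits hW hWY hWS hWX) Rf
              (stdZone ΛS (schedLayout_OK hW hLq hX hY hS hWF) hWZ)
              (GRTableMach.data LevelCode.clamp S₀ (4 * (2 * m + schedL I.n e T m + 3)) U (2 * m + 1) (schedL I.n e T m) np hnp₀)
              (stdEmb (⟨I.n, 1⟩ : LatticeInstance) (Λ := ΛS) (schedLayout_OK hW hLq hX hY hS hWF) hWE)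
              (srcU (⟨I.n, 1⟩ : LatticeInstance) ΛS p₀)
              (2 * m + 4) (by omega) hWF).runOn 0
          (basisState (boxLab (stdEmb I (schedLayout_OK hW hLq hX hY hS hWF) hWE)
              (GRData.ws (schedL I.n e T m) np (wlen LevelCode.clamp (schedL I.n e T m) np) (2 * m + 1 + 1))
            (GRData.init (mach LevelCode.clamp (Spar (2 ^ schedR I.n e T m) (detA I) aq ρ I.n)
              (4 * (2 * m + schedL I.n e T m + 3)) U (2 * m + 1) (schedL I.n e T m) np hnp))
            (lab₀ I ΛS (2 ^ schedR I.n e T m) (tW (aq : ℝ) (ρ : ℝ) I.n) (zoneOf Fq ((parOf I, 2 ^ schedR I.n e T m), e')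
              (padWord g (mach LevelCode.clamp (Spar (2 ^ schedR I.n e T m) (detA I) aq ρ I.n)
                (4 * (2 * m + schedL I.n e T m + 3)) U (2 * m + 1) (schedL I.n e T m) np hnp).c pad')) x')
            fun _ => GRData.init (mach LevelCode.clamp (Spar (2 ^ schedR I.n e T m) (detA I) aq ρ I.n)
              (4 * (2 * m + schedL I.n e T m + 3)) U (2 * m + 1) (schedL I.n e T m) np hnp) ∘
              GRData.ws (schedL I.n e T m) np (wlen LevelCode.clamp (schedL I.n e T m) np) (2 * m + 1 + 1))))).map
        fun z => decZ I (2 ^ schedR I.n e T m) (readS (Sblk I (schedLayout_OK (n := I.n) (e := e) (T := T) (m := m) hW hLq hX hY hS hWF)) z)).tvDist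
      ((discreteGaussian I.lattice ((ρ : ℝ) * Real.sqrt I.n / aq) 0).map I.intCoords) ≤
      8 * Real.sqrt (weightedFail Rf I r k y ((aq : ℝ) / (Real.sqrt 2 * ρ))
              (dataLaw (boxSet I.n (schedL I.n e T m) (DT I (2 ^ schedR I.n e T m) (tW (aq : ℝ) (ρ : ℝ) I.n)))
                (fun x => (gaussianFunction 1 x / zBox (boxSet I.n (schedL I.n e T m) (DT I (2 ^ schedR I.n e T m) (tW (aq : ℝ) (ρ : ℝ) I.n)))) ^ 2)
                (fun _ _ => sq_nonneg _)
                (sum_boxWeight_eq_one (boxSet_nonempty I.n (schedL I.n e T m) (DT I (2 ^ schedR I.n e T m) (tW (aq : ℝ) (ρ : ℝ) I.n))))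
                (cOf I ΛS (tW (aq : ℝ) (ρ : ℝ) I.n)))).toReal + νlevel I.n := by
  have h := tvDist_machineCircPar_le_std I e T m L Lq W hW hI he hne he2 hn5 hm hLq hX hY hS hWY hWS hWX hWF aq ρ haq hρ htT hTt
    hprom r k y e' Fq pad' hFq0 hFq Rf hWZ U np hnp p₀ g hp hg huz hWE x' hU
  have e1 : machineCircPar I (schedLayout_OK hW hLq hX hY hS hWF) (schedLayout_fits hW hWY hWS hWX) Rf (stdZone ΛS (schedLayout_OK hW hLq hX hY hS hWF) hWZ)
      (GRTableMach.data LevelCode.clamp (Spar (2 ^ schedR I.n e T m) (detA I) aq ρ I.n)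
      (4 * (2 * m + schedL I.n e T m + 3)) U (2 * m + 1) (schedL I.n e T m) np hnp)
      (stdEmb I (schedLayout_OK hW hLq hX hY hS hWF) hWE) (srcU I ΛS p₀) (2 * m + 4) (by omega) hWF =
    machineCircPar I (schedLayout_OK hW hLq hX hY hS hWF) (schedLayout_fits hW hWY hWS hWX) Rf (stdZone ΛS (schedLayout_OK hW hLq hX hY hS hWF) hWZ)
      (GRTableMach.data LevelCode.clamp S₀ (4 * (2 * m + schedL I.n e T m + 3)) U (2 * m + 1) (schedL I.n e T m) np hnp₀)
      (stdEmb I (schedLayout_OK hW hLq hX hY hS hWF) hWE) (srcU I ΛS p₀) (2 * m + 4) (by omega) hWF :=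
    machineCircPar_eq_of_table I (schedLayout_OK hW hLq hX hY hS hWF) (schedLayout_fits hW hWY hWS hWX) Rf (stdZone ΛS (schedLayout_OK hW hLq hX hY hS hWF) hWZ) LevelCode.clamp _ S₀ _ U (2 * m + 1) np hnp hnp₀ _ _ (2 * m + 4) _ hWF
  have e2 : machineCircPar I (schedLayout_OK hW hLq hX hY hS hWF) (schedLayout_fits hW hWY hWS hWX) Rf (stdZone ΛS (schedLayout_OK hW hLq hX hY hS hWF) hWZ)
      (GRTableMach.data LevelCode.clamp S₀ (4 * (2 * m + schedL I.n e T m + 3)) U (2 * m + 1) (schedL I.n e T m) np hnp₀)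
      (stdEmb I (schedLayout_OK hW hLq hX hY hS hWF) hWE) (srcU I ΛS p₀) (2 * m + 4) (by omega) hWF =
    machineCircPar (⟨I.n, 1⟩ : LatticeInstance) (Λ := ΛS) (schedLayout_OK hW hLq hX hY hS hWF) (schedLayout_fits hW hWY hWS hWX) Rf (stdZone ΛS (schedLayout_OK hW hLq hX hY hS hWF) hWZ)
      (GRTableMach.data LevelCode.clamp S₀ (4 * (2 * m + schedL I.n e T m + 3)) U (2 * m + 1) (schedL I.n e T m) np hnp₀)
      (stdEmb (⟨I.n, 1⟩ : LatticeInstance) (Λ := ΛS) (schedLayout_OK hW hLq hX hY hS hWF) hWE) (srcU (⟨I.n, 1⟩ : LatticeInstance) ΛS p₀) (2 * m + 4) (by omega) hWF := rfl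
  rw [e1, e2] at h
  exact h

end Par

end SamplerRegs

end Regev2009

end Literature.Computability.Cryptography

end
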